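import Summits.AtomisticToContinuum.HydrodynamicLimit.Theorems.OneFlightGossipEngineEnergyCurrentTailsLevelCensusPreMarkFlux
import HarnessLib

/-!
# Rung ½ for the crux `EnergyCurrentTails` (stmt-AtomisticToContinuum-9235), line
# `level-census-comparison` (seat c4): stub D' `stub_collisionCountShortTime`

Helper file (`--supports stmt-AtomisticToContinuum-9235`).  Stub D' of the rung-½ skeleton
refuting `stub_contactIntensityDomination` (stmt-9218): GIVEN the law domination (stub A, taken
here as a hypothesis: `λ_{a,u,θ₀} ≤ ((θmax/θmin)^{3/2})^{N+1} • λ_{a,u,θmax}` whenever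
`θmin ≤ θ₀ ≤ θmax`), at FIXED `N ≥ 1` the expected number of collision times of the hard-sphere
orbit in the window `(0, h]` under the hot-spot local Gibbs law (activity `a`, drift `0`,
temperature `θhot x = 2 − ‖x‖ ∈ [3/2, 2]`) is `O(h)`:

* `ncard_collisionTimes_le_collisionPairSum_one` — PATHWISE: on a good orbit the number of
  collision times in a window is at most the collision pair sum of the constant mark `1`
  (every collision time carries at least one ordered contact pair);
* `lintegral_norm_sub_prod_gaussMeasure_lt_top` — STATICS: the Gaussian flux moment
  `∫ ‖v − w‖ dN(u,θ)^{⊗2}` is finite (first moments of a Gaussian measure, Fernique);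
* `stub_collisionCountShortTime` — the registered stub: domination by the homogeneous law at
  `θ = 2` (`K = ((2/(3/2))^{3/2})^{N+1}`), then the rung-0 pre-mark flux bound
  `localGibbsLaw_lintegral_le_of_le_collisionPreMarkSum` with the mark `A ≡ 1`, giving
  `E #coll(0,h] ≤ K · 16 h (N+1)² ε_N² · ∫ ‖v − w‖ dN(0,2)^{⊗2}`.

References: C. Cercignani, R. Illner, M. Pulvirenti, *The Mathematical Theory of Dilute Gases*
(1994), App. 4.A.
-/

noncomputable section

open MeasureTheory Set Filter
open scoped ENNReal InnerProductSpace BigOperators Classical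

namespace Summit.AtomisticToContinuum.HydrodynamicLimit.Theorems.EnergyCurrentTailsRungHalf

open Literature.MathematicalPhysics.KineticTheory Literature.Analysis.FluidPDE
open Summit.AtomisticToContinuum.HydrodynamicLimit.Theorems.EnergyCurrentTailsLevelCensus

/-! ### Pathwise: collision times are counted by the constant mark -/

/-- **The number of collision times in a window is at most the collision pair sum of the mark
`1`.**  On a good orbit the collision times in `(0, h]` are finitely many and each carries a
nonempty set of ordered contact pairs (`mem_collisionTimes_iff_contactPairs_nonempty`), so
`#(collisionTimes ∩ (0,h]) = Σ_t 1 ≤ Σ_t #contactPairs(t) = collisionPairSum (0,h] 1`.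
[folklore] -/
theorem ncard_collisionTimes_le_collisionPairSum_one {σ : ℝ} {N : ℕ}
    (Φ : HardSphereFlow (Torus.geometry (Fin 3)) (hsDiameter σ N) (N + 1))
    {z : Config (N + 1) (Fin 3) T3} (hz : z ∈ Φ.good) (h : ℝ) :
    ((collisionTimes (Torus.geometry (Fin 3)) (hsDiameter σ N) (fun r => Φ.flow r z) ∩
        Set.Ioc 0 h).ncard : ℝ≥0∞) ≤
      Φ.collisionPairSum (Ioc 0 h) (fun _ _ _ _ => (1 : ℝ≥0∞)) z := by
  have hfin : (collisionTimes (Torus.geometry (Fin 3)) (hsDiameter σ N) (fun r => Φ.flow r z) ∩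
      Ioc 0 h).Finite :=
    Φ.finite_collisionTimes_inter hz Ioc_subset_Icc_self
  unfold HardSphereFlow.collisionPairSum
  rw [collisionPairSum_eq_finset_sum hfin, Set.ncard_eq_toFinset_card _ hfin,
    Finset.card_eq_sum_ones, Nat.cast_sum]
  refine Finset.sum_le_sum fun t ht => ?_
  rw [Finset.sum_const, nsmul_eq_mul, mul_one, Nat.cast_one]
  have hne : (contactPairs (Torus.geometry (Fin 3)) (hsDiameter σ N) (Φ.flow t z)).Nonempty :=
    (mem_collisionTimes_iff_contactPairs_nonempty (γ := fun r => Φ.flow r z)).1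
      (hfin.mem_toFinset.1 ht).1
  exact_mod_cast hne.card_pos

/-! ### Statics: the Gaussian flux moment of the constant mark is finite -/

/-- The mean speed of a Gaussian is finite: `∫⁻ ‖w‖ dN(u,θ) < ∞` (first absolute moment of a
Gaussian measure, Fernique). [folklore] -/
theorem lintegral_norm_gaussMeasure_lt_top (u : V3) (θ : ℝ) :
    ∫⁻ w, ENNReal.ofReal ‖w‖ ∂(gaussMeasure u θ) < ⊤ := by
  have hi : Integrable (id : V3 → V3) (gaussMeasure u θ) :=
    memLp_one_iff_integrable.1
      (ProbabilityTheory.IsGaussian.memLp_id (gaussMeasure u θ) 1 (by simp))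
  have h2 : ∫⁻ w, ‖id w‖ₑ ∂(gaussMeasure u θ) < ⊤ := hasFiniteIntegral_iff_enorm.1 hi.2
  simpa only [id_eq, ofReal_norm] using h2

/-- **The Gaussian flux moment of the constant mark is finite**:
`∫ ‖v − w‖ dN(u,θ)(v) dN(u,θ)(w) ≤ 2 ∫ ‖w‖ dN(u,θ) < ∞` (`‖v − w‖ ≤ ‖v‖ + ‖w‖`, Tonelli).
[folklore] -/
theorem lintegral_norm_sub_prod_gaussMeasure_lt_top (u : V3) (θ : ℝ) :
    ∫⁻ p, ENNReal.ofReal ‖p.1 - p.2‖ ∂((gaussMeasure u θ).prod (gaussMeasure u θ)) < ⊤ := by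
  set γ : Measure V3 := gaussMeasure u θ
  have hM := lintegral_norm_gaussMeasure_lt_top u θ
  have hm1 : Measurable fun p : V3 × V3 => ENNReal.ofReal ‖p.1‖ :=
    measurable_fst.norm.ennreal_ofReal
  have hm2 : Measurable fun p : V3 × V3 => ENNReal.ofReal ‖p.2‖ :=
    measurable_snd.norm.ennreal_ofReal
  have h1 : ∫⁻ p, ENNReal.ofReal ‖p.1‖ ∂(γ.prod γ) = ∫⁻ w, ENNReal.ofReal ‖w‖ ∂γ := by
    rw [lintegral_prod _ hm1.aemeasurable]
    simp only [lintegral_const, measure_univ, mul_one]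
  have h2 : ∫⁻ p, ENNReal.ofReal ‖p.2‖ ∂(γ.prod γ) = ∫⁻ w, ENNReal.ofReal ‖w‖ ∂γ := by
    rw [lintegral_prod _ hm2.aemeasurable]
    simp only [lintegral_const, measure_univ, mul_one]
  calc ∫⁻ p, ENNReal.ofReal ‖p.1 - p.2‖ ∂(γ.prod γ)
      ≤ ∫⁻ p, (ENNReal.ofReal ‖p.1‖ + ENNReal.ofReal ‖p.2‖) ∂(γ.prod γ) := by
        refine lintegral_mono fun p => ?_
        rw [← ENNReal.ofReal_add (norm_nonneg _) (norm_nonneg _)]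
        exact ENNReal.ofReal_le_ofReal (norm_sub_le _ _)
    _ = ∫⁻ w, ENNReal.ofReal ‖w‖ ∂γ + ∫⁻ w, ENNReal.ofReal ‖w‖ ∂γ := by
        rw [lintegral_add_left hm1, h1, h2]
    _ < ⊤ := ENNReal.add_lt_top.2 ⟨hM, hM⟩

/-! ### The registered stub -/

/-- **Registered stub D' `stub_collisionCountShortTime` — SHORT-TIME COLLISION COUNT under the
hot-spot law (given stub A).**  Assume the law domination (stub A): for continuous `θ₀` with
`0 < θmin ≤ θ₀ ≤ θmax` and `a > 0`, `λ_{a,u,θ₀} ≤ ((θmax/θmin)^{3/2})^{N+1} • λ_{a,u,θmax}`.  Then at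
small reduced density, for `a > 0`, FIXED `N ≥ 1` and every flow `Φ`, there is `C ≥ 0` with, for
every `h > 0`, `E_{λhot} #(collisionTimes ∩ (0,h]) ≤ C h`, `λhot` the local Gibbs law of activity
`a`, drift `0`, temperature `x ↦ 2 − ‖x‖` (values in `[3/2, 2]` since `‖x‖ ≤ 1/2` on `𝕋³`).
Proof: domination by the homogeneous law at `θ = 2` with `K = ((2/(3/2))^{3/2})^{N+1}`
(`lintegral_mono'`, `lintegral_smul_measure`); pathwise the count is at most the collision pair
sum of the mark `1` (`ncard_collisionTimes_le_collisionPairSum_one`, `Φ.flow_zero`); the rung-0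
pre-mark flux bound `localGibbsLaw_lintegral_le_of_le_collisionPreMarkSum` gives
`≤ 16 h (N+1)² ε_N² ∫ ‖v − w‖ dN(0,2)^{⊗2}`, finite by
`lintegral_norm_sub_prod_gaussMeasure_lt_top`; `C = K · 16 (N+1)² ε_N² · ∫ ‖v − w‖ dN(0,2)^{⊗2}`.
[folklore] -/
theorem stub_collisionCountShortTime :
    (∀ (σ a : ℝ) (u : V3) (θ₀ : T3 → ℝ) (θmin θmax : ℝ), Continuous θ₀ → 0 < θmin →
      (∀ x, θmin ≤ θ₀ x) → (∀ x, θ₀ x ≤ θmax) → 0 < a →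
      ∀ (N : ℕ) (Φ : HardSphereFlow (Torus.geometry (Fin 3)) (hsDiameter σ N) (N + 1)),
        localGibbsLaw σ (fun _ => a) (fun _ => u) θ₀ N Φ ≤
          ENNReal.ofReal (((θmax / θmin) ^ ((3 : ℝ) / 2)) ^ (N + 1)) •
            localGibbsLaw σ (fun _ => a) (fun _ => u) (fun _ => θmax) N Φ) →
    ∀ (σ : ℝ), SmallDensity uniformProfile σ → ∀ (a : ℝ), 0 < a → ∀ (N : ℕ), 1 ≤ N →
      ∀ (Φ : HardSphereFlow (Torus.geometry (Fin 3)) (hsDiameter σ N) (N + 1)),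
        ∃ C : ℝ, 0 ≤ C ∧ ∀ h : ℝ, 0 < h →
          ∫⁻ z, ((collisionTimes (Torus.geometry (Fin 3)) (hsDiameter σ N) (fun r => Φ.flow r z) ∩
              Set.Ioc 0 h).ncard : ℝ≥0∞)
            ∂(localGibbsLaw σ (fun _ => a) (fun _ => (0 : V3)) (fun x => 2 - ‖x‖) N Φ) ≤
          ENNReal.ofReal (C * h) := by
  intro hdom σ hsm a ha N hN Φ
  -- the domination constant, the homogeneous law at `θ = 2`, the Gaussian flux moment
  set Kr : ℝ := (((2 : ℝ) / (3 / 2)) ^ ((3 : ℝ) / 2)) ^ (N + 1)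
  have hKr0 : 0 ≤ Kr := pow_nonneg (Real.rpow_nonneg (by norm_num) _) _
  set lhot := localGibbsLaw σ (fun _ => a) (fun _ => (0 : V3)) (fun x => 2 - ‖x‖) N Φ
  set lhom := localGibbsLaw σ (fun _ => a) (fun _ => (0 : V3)) (fun _ => (2 : ℝ)) N Φ
  set I : ℝ≥0∞ := ∫⁻ p, ENNReal.ofReal ‖p.1 - p.2‖
    ∂((gaussMeasure (0 : V3) 2).prod (gaussMeasure (0 : V3) 2))
  have hItop : I ≠ ⊤ := (lintegral_norm_sub_prod_gaussMeasure_lt_top (0 : V3) 2).ne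
  set D : ℝ := 16 * ((N + 1 : ℕ) : ℝ) ^ 2 * hsDiameter σ N ^ 2 with hD
  have hD0 : 0 ≤ D := by positivity
  -- (1) domination of the hot-spot law by the homogeneous law at `θ = 2`
  have hle : lhot ≤ ENNReal.ofReal Kr • lhom := by
    have hθc : Continuous fun x : T3 => (2 : ℝ) - ‖x‖ := continuous_const.sub continuous_norm
    have hlo : ∀ x : T3, (3 : ℝ) / 2 ≤ 2 - ‖x‖ := fun x => by
      have hx : ‖x‖ ≤ 1 / 2 := by
        rw [pi_norm_le_iff_of_nonneg (by norm_num)]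
        intro i
        simpa using AddCircle.norm_le_half_period (1 : ℝ) (x := x i) one_ne_zero
      linarith
    have hhi : ∀ x : T3, (2 : ℝ) - ‖x‖ ≤ 2 := fun x => by linarith [norm_nonneg x]
    exact hdom σ a (0 : V3) (fun x => 2 - ‖x‖) (3 / 2) 2 hθc (by norm_num) hlo hhi ha N Φ
  -- (2) the rung-0 pre-mark flux bound with the mark `A ≡ 1`
  refine ⟨Kr * D * I.toReal, by positivity, fun h hh => ?_⟩
  have hf : ∀ z ∈ Φ.good,
      ((collisionTimes (Torus.geometry (Fin 3)) (hsDiameter σ N) (fun r => Φ.flow r z) ∩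
          Set.Ioc 0 h).ncard : ℝ≥0∞) ≤
        Φ.collisionPairSum (Ioc 0 h)
          (fun _ w i j => (fun _ : V3 × V3 => (1 : ℝ≥0∞))
            (reflectVel ((Torus.geometry (Fin 3)).sepVec (w i).1 (w j).1) ((w i).2, (w j).2)))
          (Φ.flow 0 z) := by
    intro z hz
    rw [Φ.flow_zero z hz]
    exact ncard_collisionTimes_le_collisionPairSum_one Φ hz h
  have hhom := localGibbsLaw_lintegral_le_of_le_collisionPreMarkSum hsm ha
    (by norm_num : (0 : ℝ) < 2) (0 : V3) hN Φ hh (A := fun _ : V3 × V3 => (1 : ℝ≥0∞))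
    measurable_const 0 hf
  simp only [mul_one] at hhom
  -- (3) assembly
  calc ∫⁻ z, ((collisionTimes (Torus.geometry (Fin 3)) (hsDiameter σ N) (fun r => Φ.flow r z) ∩
          Set.Ioc 0 h).ncard : ℝ≥0∞) ∂lhot
      ≤ ∫⁻ z, ((collisionTimes (Torus.geometry (Fin 3)) (hsDiameter σ N) (fun r => Φ.flow r z) ∩
          Set.Ioc 0 h).ncard : ℝ≥0∞) ∂(ENNReal.ofReal Kr • lhom) :=
        lintegral_mono' hle le_rfl
    _ = ENNReal.ofReal Kr * ∫⁻ z, ((collisionTimes (Torus.geometry (Fin 3)) (hsDiameter σ N)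
          (fun r => Φ.flow r z) ∩ Set.Ioc 0 h).ncard : ℝ≥0∞) ∂lhom := by
        rw [lintegral_smul_measure, smul_eq_mul]
    _ ≤ ENNReal.ofReal Kr *
          (ENNReal.ofReal (16 * h * ((N + 1 : ℕ) : ℝ) ^ 2 * hsDiameter σ N ^ 2) * I) :=
        mul_le_mul_right hhom _
    _ = ENNReal.ofReal (Kr * D * I.toReal * h) := by
        rw [show Kr * D * I.toReal * h =
            Kr * (16 * h * ((N + 1 : ℕ) : ℝ) ^ 2 * hsDiameter σ N ^ 2) * I.toReal by
          rw [hD]; ring]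
        rw [ENNReal.ofReal_mul (by positivity :
            (0 : ℝ) ≤ Kr * (16 * h * ((N + 1 : ℕ) : ℝ) ^ 2 * hsDiameter σ N ^ 2)),
          ENNReal.ofReal_mul hKr0, ENNReal.ofReal_toReal hItop]
        exact (mul_assoc _ _ _).symm

end Summit.AtomisticToContinuum.HydrodynamicLimit.Theorems.EnergyCurrentTailsRungHalf

end
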